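import Summits.QuantumFields.YangMills.Theorems.FluctuationComparisonRegPrIntLOrganTangentJensenGapTools
import HarnessLib

/-!
# Crux `FluctuationComparisonRegPrIntL` (stmt-QuantumFields-20520, rung R3), PATH-B organ O1, LINE g26-2 «jensen_cumulant» (ideator ym-r3-idea-1 g26), rows
# VAR∘ ∕ LME3∘ — TOOLS: the cumulant Taylor formula with INTEGRAL remainder TO THIRD ORDER (the cumulant tail `g − q` is the integrated tilted third
# truncated expectation) and the four-point transfer with factor `1∕6`

LEAD-20520 width seat ym-ust-20520-w3 g23 (cell ym3-torus), `--supports stmt-QuantumFields-20520` (helper).  THEOREMS ONLY, def-free, generic [folklore]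
calculus over Mathlib and the tree (✓`…OrganTangentJensenGapTools` second-order form; ✓`B10Eq24Cumulant.contDiff_cgf_of_abs_le`, `truncExp_tilted`).

WHY.  LINE g26-2 cuts JEN∘'s Jensen gap `g = f(1) − f(0) − f′(0)` (`f = cgf h P_V`, ✓`…OrganTangentJensenGapKnit`) as `g = q + (g − q)`,
`q = ½·f″(0)` = half the χ-conditioned fibre variance (row VAR∘) and the CUMULANT TAIL `g − q` (row LME3∘).  Here: ★`sub_sub_sub_eq_integral_of_contDiff_three`
(`f 1 − f 0 − f′ 0 − f″ 0∕2 = ∫₀¹ ((1−t)²∕2)·f‴(t) dt` for `C³` `f`), ★`cgf_taylor_three_integral` ∕ ★`cgf_taylor_three_integral_truncExp` (for `|V| ≤ B`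
`ν`-a.e., `ν` finite non-zero: the tail is `∫₀¹ ((1−t)²∕2)·⟨V³⟩ᵀ_{e^{tV}ν} dt`, the TILTED THIRD TRUNCATED EXPECTATION of [Balaban1982Higgs1] (3.23) —
«tilting = shifting» — continuous in `t`), `integral_one_sub_sq_div_two` (`= 1∕6`), ★`abs_fourPoint_integral_sq_le` ∕ ★`abs_fourPoint_le_of_eq_integral_sq`
(a `t`-uniform bound `W₀·e` on a four-point combination of the `A_x` gives `(W₀∕6)·e` for the represented function).

HONEST FRAMING: elementary; nothing of Bałaban's is asserted or proved; VAR∘, LME3∘, JEN∘, O1, crux 20520, `YM3TorusSU2` are NOT proved; registry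
`Lines/semiclassical_s2beta.lean` v11.4 (★★OWNER RULING №36) untouched; rung R3 = SU(2) YM₃ on T³ — NOT d = 4, NOT infinite volume, NOT a mass gap, NOT
Clay; the Yang–Mills mass gap is NOT proved by any of this.
-/

set_option autoImplicit false

noncomputable section

namespace Summit.QuantumFields.YangMills.Theorems.OrganTangentCumulantTailTools

open MeasureTheory ProbabilityTheory Filter Topology Set intervalIntegral
open scoped ENNReal
open Literature.MathematicalPhysics.QuantumFieldTheory.Balaban1983to89.B10Eq24Cumulant
open Summit.QuantumFields.YangMills.Theorems.OrganTangentJensenGapTools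

section Taylor3

variable {Ω : Type*} {mΩ : MeasurableSpace Ω} {V : Ω → ℝ} {ν : Measure Ω} {B : ℝ} [IsFiniteMeasure ν]

/-- Taylor's formula with INTEGRAL remainder to third order on `[0, 1]` for a `C³` function `f : ℝ → ℝ`:
`f 1 − f 0 − f′ 0 − f″ 0 ∕ 2 = ∫₀¹ ((1 − t)²∕2)·f‴(t) dt`. [folklore] -/
theorem sub_sub_sub_eq_integral_of_contDiff_three {f : ℝ → ℝ} (hf : ContDiff ℝ 3 f) :
    f 1 - f 0 - deriv f 0 - iteratedDeriv 2 f 0 / 2 =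
      ∫ t in (0 : ℝ)..1, (1 - t) ^ 2 / 2 * iteratedDeriv 3 f t := by
  have hf2 : ContDiff ℝ 2 f := hf.of_le (by norm_num)
  have h2 := sub_sub_deriv_eq_integral_of_contDiff_two hf2
  have hd2 : Differentiable ℝ (iteratedDeriv 2 f) := hf.differentiable_iteratedDeriv 2 (by norm_num)
  have hc3 : Continuous (iteratedDeriv 3 f) := hf.continuous_iteratedDeriv 3 le_rfl
  have hc2 : Continuous (iteratedDeriv 2 f) := hf.continuous_iteratedDeriv 2 (by norm_num)
  have hder : ∀ t, HasDerivAt (iteratedDeriv 2 f) (iteratedDeriv 3 f t) t := fun t => by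
    have := (hd2 t).hasDerivAt
    rwa [← iteratedDeriv_succ] at this
  have hparts := intervalIntegral.integral_mul_deriv_eq_deriv_mul (a := (0 : ℝ)) (b := 1)
    (u := fun t : ℝ => (1 - t) ^ 2 / 2) (u' := fun t : ℝ => -(1 - t)) (v := iteratedDeriv 2 f) (v' := iteratedDeriv 3 f)
    (fun t _ => by
      have h' : HasDerivAt (fun x : ℝ => (1 - x) ^ 2 / 2) (((2 : ℕ) : ℝ) * (1 - t) ^ (2 - 1) * (-1) / 2) t :=
        (((hasDerivAt_id' t).const_sub 1).pow 2).div_const 2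
      exact h'.congr_deriv (by norm_num; ring))
    (fun t _ => hder t)
    ((continuous_const.sub continuous_id).neg.intervalIntegrable _ _) (hc3.intervalIntegrable _ _)
  rw [hparts]
  have hrest : ∫ t in (0 : ℝ)..1, -(1 - t) * iteratedDeriv 2 f t = -(f 1 - f 0 - deriv f 0) := by
    rw [h2, ← intervalIntegral.integral_neg]
    refine intervalIntegral.integral_congr fun t _ => ?_
    ring
  rw [hrest]
  ring

/-- **THE CUMULANT TAYLOR FORMULA WITH INTEGRAL REMAINDER, THIRD ORDER** (bounded variable, finite measure):
`f(1) − f(0) − f′(0) − f″(0)∕2 = ∫₀¹ ((1 − t)²∕2)·f‴(t) dt`, `f = cgf V ν`; by «tilting = shifting» (tree ✓`B10Eq24Cumulant.truncExp_tilted`) `f‴(t)` is the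
third truncated expectation `⟨V³⟩ᵀ` of `V` under the interpolating law `e^{tV}ν∕Z(t)`. [folklore] -/
theorem cgf_taylor_three_integral (hV : AEMeasurable V ν) (hB : ∀ᵐ ω ∂ν, |V ω| ≤ B) :
    cgf V ν 1 - cgf V ν 0 - deriv (cgf V ν) 0 - iteratedDeriv 2 (cgf V ν) 0 / 2 =
      ∫ t in (0 : ℝ)..1, (1 - t) ^ 2 / 2 * iteratedDeriv 3 (cgf V ν) t :=
  sub_sub_sub_eq_integral_of_contDiff_three (contDiff_cgf_of_abs_le hV hB)


/-- … with the remainder read as the TILTED THIRD TRUNCATED EXPECTATION `⟨V³⟩ᵀ_t` of [Balaban1982Higgs1] (3.23) («tilting = shifting»,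
✓`B10Eq24Cumulant.truncExp_tilted`): `f(1) − f(0) − f′(0) − f″(0)∕2 = ∫₀¹ ((1 − t)²∕2)·⟨V³⟩ᵀ_{e^{tV}ν} dt`, and `t ↦ ⟨V³⟩ᵀ_t` is continuous. [folklore] -/
theorem cgf_taylor_three_integral_truncExp [NeZero ν] (hV : AEMeasurable V ν) (hB : ∀ᵐ ω ∂ν, |V ω| ≤ B) :
    Continuous (fun t : ℝ => truncExp V (ν.tilted fun ω => t * V ω) 3) ∧
    cgf V ν 1 - cgf V ν 0 - deriv (cgf V ν) 0 - iteratedDeriv 2 (cgf V ν) 0 / 2 =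
      ∫ t in (0 : ℝ)..1, (1 - t) ^ 2 / 2 * truncExp V (ν.tilted fun ω => t * V ω) 3 := by
  have h : (fun t : ℝ => truncExp V (ν.tilted fun ω => t * V ω) 3) = fun t => iteratedDeriv 3 (cgf V ν) t :=
    funext fun t => truncExp_tilted hV hB t (by norm_num)
  refine ⟨?_, ?_⟩
  · rw [h]; exact (contDiff_cgf_of_abs_le hV hB (n := 3)).continuous_iteratedDeriv 3 le_rfl
  · rw [cgf_taylor_three_integral hV hB]
    refine intervalIntegral.integral_congr fun t _ => ?_
    show (1 - t) ^ 2 / 2 * iteratedDeriv 3 (cgf V ν) t = (1 - t) ^ 2 / 2 * truncExp V (ν.tilted fun ω => t * V ω) 3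
    rw [truncExp_tilted hV hB t (by norm_num)]

/-- `∫₀¹ (1 − t)²∕2 dt = 1∕6`. [folklore] -/
theorem integral_one_sub_sq_div_two : ∫ t in (0 : ℝ)..1, (1 - t) ^ 2 / 2 = 1 / 6 := by
  have h := intervalIntegral.integral_comp_sub_left (fun s : ℝ => s ^ 2 / 2) (1 : ℝ) (a := 0) (b := 1)
  simp only [sub_self, sub_zero] at h
  rw [h, intervalIntegral.integral_div, integral_pow]
  norm_num

/-- **Four-point transfer, third order**: a `t`-uniform bound `W₀·e` on a four-point combination of continuous `A_x` gives `(W₀∕6)·e` for the same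
combination of `x ↦ ∫₀¹ ((1−t)²∕2)·A_x(t) dt`. [folklore] -/
theorem abs_fourPoint_integral_sq_le {AU AV AW AZ : ℝ → ℝ} (hU : Continuous AU) (hV : Continuous AV) (hW : Continuous AW)
    (hZ : Continuous AZ) {W₀ e : ℝ}
    (h : ∀ t ∈ Icc (0 : ℝ) 1, |AU t - AV t - (AW t - AZ t)| ≤ W₀ * e) :
    |(∫ t in (0 : ℝ)..1, (1 - t) ^ 2 / 2 * AU t) - (∫ t in (0 : ℝ)..1, (1 - t) ^ 2 / 2 * AV t) -
        ((∫ t in (0 : ℝ)..1, (1 - t) ^ 2 / 2 * AW t) - (∫ t in (0 : ℝ)..1, (1 - t) ^ 2 / 2 * AZ t))| ≤ W₀ / 6 * e := by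
  have hw : Continuous fun t : ℝ => (1 - t) ^ 2 / 2 := by fun_prop
  have hi : ∀ {g : ℝ → ℝ}, Continuous g → IntervalIntegrable (fun t => (1 - t) ^ 2 / 2 * g t) volume 0 1 :=
    fun hg => (hw.mul hg).intervalIntegrable _ _
  have hcomb : (∫ t in (0 : ℝ)..1, (1 - t) ^ 2 / 2 * AU t) - (∫ t in (0 : ℝ)..1, (1 - t) ^ 2 / 2 * AV t) -
      ((∫ t in (0 : ℝ)..1, (1 - t) ^ 2 / 2 * AW t) - (∫ t in (0 : ℝ)..1, (1 - t) ^ 2 / 2 * AZ t)) =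
      ∫ t in (0 : ℝ)..1, (1 - t) ^ 2 / 2 * (AU t - AV t - (AW t - AZ t)) := by
    rw [← intervalIntegral.integral_sub (hi hU) (hi hV), ← intervalIntegral.integral_sub (hi hW) (hi hZ),
      ← intervalIntegral.integral_sub ((hi hU).sub (hi hV)) ((hi hW).sub (hi hZ))]
    refine intervalIntegral.integral_congr fun t _ => ?_
    ring
  rw [hcomb]
  have hD : Continuous fun t => AU t - AV t - (AW t - AZ t) := (hU.sub hV).sub (hW.sub hZ)
  calc |∫ t in (0 : ℝ)..1, (1 - t) ^ 2 / 2 * (AU t - AV t - (AW t - AZ t))|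
      ≤ ∫ t in (0 : ℝ)..1, |(1 - t) ^ 2 / 2 * (AU t - AV t - (AW t - AZ t))| :=
        intervalIntegral.abs_integral_le_integral_abs zero_le_one
    _ ≤ ∫ t in (0 : ℝ)..1, (1 - t) ^ 2 / 2 * (W₀ * e) := by
        refine intervalIntegral.integral_mono_on zero_le_one ((hi hD).abs) (hi continuous_const) fun t ht => ?_
        have hnn : (0 : ℝ) ≤ (1 - t) ^ 2 / 2 := by positivity
        rw [abs_mul, abs_of_nonneg hnn]
        exact mul_le_mul_of_nonneg_left (h t ht) hnn
    _ = W₀ / 6 * e := by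
        rw [intervalIntegral.integral_mul_const, integral_one_sub_sq_div_two]; ring


/-- **Four-point transfer through the third-order integral representation**: if on a set `S` a function `r` is represented as
`r x = ∫₀¹ ((1 − t)²∕2)·A_x(t) dt` with `A_x` continuous, a `t`-uniform bound `W₀·e` on a four-point combination of the `A_x` gives `(W₀∕6)·e`
for the same combination of `r`.  (The LME3∘ use: `r` = the cumulant tail `g − q`, `A_V(t)` = the tilted third truncated expectation.) [folklore] -/
theorem abs_fourPoint_le_of_eq_integral_sq {X : Type*} {S : Set X} {r : X → ℝ} {A : X → ℝ → ℝ}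
    (hr : ∀ x ∈ S, Continuous (A x) ∧ r x = ∫ t in (0 : ℝ)..1, (1 - t) ^ 2 / 2 * A x t)
    {U V W Z : X} (hU : U ∈ S) (hV : V ∈ S) (hW : W ∈ S) (hZ : Z ∈ S) {W₀ e : ℝ}
    (h4 : ∀ t ∈ Icc (0 : ℝ) 1, |A U t - A V t - (A W t - A Z t)| ≤ W₀ * e) :
    |r U - r V - (r W - r Z)| ≤ W₀ / 6 * e := by
  rw [(hr U hU).2, (hr V hV).2, (hr W hW).2, (hr Z hZ).2]
  exact abs_fourPoint_integral_sq_le (hr U hU).1 (hr V hV).1 (hr W hW).1 (hr Z hZ).1 h4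

end Taylor3

end Summit.QuantumFields.YangMills.Theorems.OrganTangentCumulantTailTools

end
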